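import Summits.HodgeConjecture.HodgeConjecture.Theorems.VHCAbelianSchemesRoadSupertracePullback
import Summits.Ventures.HSemireg.ComplexAtiyahPushforward
import Literature.AlgebraicGeometry.HodgeTheory.TwistJetPullbackNaturality
import HarnessLib

/-!
# Road №4 (`VHCAbelianSchemesRoad`), crux stmt-HodgeConjecture-26512 `DiagLocalOfMarkmanPinnedForall` — support line «sigma-descent-along-q»,
# library item (L2) `SigmaPullbackCompat`, step (Q4): **THE COMPLEX ATIYAH POWERS `ι• · At(K•)^q` ALONG THE PULL-BACK BY A FLAT
# MORPHISM OF `S`-SCHEMES** — the pull-back twin of `Summits/Ventures/HSemireg/ComplexAtiyahPushforward` (piece (N4) there)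

research route conditional on HC_CM; not a corollary; Q11.4-sentence-2 already refuted in dim ≥ 3.

Seat core-w5 gen 6 (width copy «width 5» of core-D; claim-free, `--supports stmt-HodgeConjecture-26512 --as helper`; director-hodge g18
R18.14 (3) PIECE B, owner of record R18.20). HONEST FRAMING: kernel bookkeeping on the venture's real carriers (`complexAtiyahStep`,
`complexAtiyahPower`, `complexAtiyahPowerFrom`, `toTwistHodgeZeroC`, `extMulAtiyahPower` of `ComplexAtiyahClass.lean` ∕ `ComplexAtiyahPower.lean`,
the argument `x · ι• · At(K•)^q` of the venture's `σ_q`, and gen 118's `mapShiftedHom`); nothing about any variety; proves NOTHING about (L2),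
(U-Σ), (N-U), any registered stub, 26512, №4, HC_AV, HC_CM or HC; HC_CM HELD, by name only; typed ≠ proved. Declared in the cell's namespace
`Summit.HodgeConjecture.HodgeConjecture.Ring2.SemiregularRepresentatives` (as the step (Q1)∕(Q5) files), with the venture's names opened.

For a morphism `g : X₀ ⟶ X₁` of `S`-schemes (`g^* = Scheme.Modules.pullback g.left`, `g^*•` termwise, and — for the derived-category
statements — `g^*` EXACT, i.e. `[PreservesFiniteLimits (Scheme.Modules.pullback g.left)]`: a flat `g`, e.g. the quotient isogeny `q` of
the support line, `IsIsogeny.preservesFiniteLimits_pullback`; `g^{**} := mapShiftedHom g^*`), a cochain complex `K` of `𝒪_{X₁}`-modules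
with finite locally free terms, `K' = g^*•K`, and the module-level base-change morphisms of `Literature/AlgebraicGeometry/HodgeTheory/`
`TwistHodgePullback` (`α_j`), `TwistJetPullback` («jets commute with base change»: `g^* Pʲ(E) ⟶ Pʲ(g^*E)`), `TwistJetPullbackNaturality`:

* §1 chain morphisms `twistJetComplexPullbackHom g j K hK : g^*• Pʲ(K) ⟶ Pʲ(K')` (termwise the jet comparison; a chain map by its
  naturality in the module) and, with (Q5)'s `twistHodgeComplexPullbackHom` (`α_j•`), the morphism of the termwise twisted Atiyah
  sequences `g^*•(0 → K⊗Ωʲ⁺¹ → Pʲ(K) → K⊗Ωʲ → 0) ⟶ (same for K')` (`twistJetComplexShortComplexPullbackHom`);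
* §2 **`mapShiftedHom_complexAtiyahStep_pullback`** — `g^{**}(At_j(K)) = δ(g^*•(Atiyah sequence))` (Mathlib
  `DerivedCategory.map_triangleOfSESδ` for the exact `g^*`) and **`mapShiftedHom_complexAtiyahStep_comp_pullback`** —
  `g^{**}(At_j(K)) · [Q α_{j+1}•] = [Q α_j•] · At_j(K')` (`triangleOfSESδ_naturality`); by induction
  **`mapShiftedHom_complexAtiyahPower_comp_pullback`** — `g^{**}(At(K)^q) · [Q α_q•] = [Q α_0•] · At(K')^q`;
* §3 `map_toTwistHodgeZeroC_comp_pullback` — `g^*•(ι•_K) ≫ α_0• = ι•_{K'}` (termwise `TwistJetPullback`'s `g^*(ι_E) ≫ α_0 = ι_{g^*E}`);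
  hence **`mapShiftedHom_complexAtiyahPowerFrom_comp_pullback`** and **`mapShiftedHom_extMulAtiyahPower_comp_pullback`** —
  `g^{**}(x · ι• · At(K)^q) · [Q α_q•] = g^{**}(x) · ι• · At(K')^q` — the (N4)-shaped input of the (Dq-σ) assembly of
  `Cruxes/…/SigmaDescent.lean` (with (Q2) `HomComplexUnitPullback`, (Q3′) `…DerivedDescentBaseChangeNatTrans`, (Q5) `…SupertracePullback`).

Unlike the isomorphism case, `α_j•` is only a MORPHISM here (one-sided statements; no inverse is used or needed).

References: R.-O. Buchweitz, H. Flenner, Compositio Math. 137 (2003), §3 (Atiyah class of a complex; functoriality under base change),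
Def. 4.1 [BuchweitzFlenner2003]; M. F. Atiyah, Trans. AMS 85 (1957), §4 Prop. 6–7 [Atiyah1957]; R. Hartshorne (1977), II Ex. 5.1,
II Prop. 8.11, II §5 p. 110 [Hartshorne1977]; C. A. Weibel (1994), §10.4, Example 10.4.9 (exact functors and connecting morphisms)
[Weibel1994]. Bookkeeping along a flat pull-back (reading; no printed statement is typed verbatim).
-/

noncomputable section

-- `TopCat.Presheaf`/`Scheme.Modules` are not reducible (as in Mathlib's `AlgebraicGeometry/Modules/Sheaf.lean`).
set_option backward.isDefEq.respectTransparency false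

open CategoryTheory CategoryTheory.Category CategoryTheory.Limits AlgebraicGeometry Opposite
open AlgebraicGeometry.Scheme.Modules DerivedCategory

universe w₀ w₁ u

namespace Summit.HodgeConjecture.HodgeConjecture.Ring2.SemiregularRepresentatives

set_option linter.dupNamespace false -- the cell's namespace repeats the summit name, as in every `Ring2*` file

open Literature.AlgebraicGeometry.Modules Literature.AlgebraicGeometry.Motives
open Literature.AlgebraicGeometry.HodgeTheory (twistHodge twistHodgePullbackHom twistJetModule twistJetι twistJetπ twistJetPullbackHom
  pullback_map_twistJetι_comp_twistJetPullbackHom pullback_map_twistJetπ_comp_twistHodgePullbackHom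
  pullback_map_twistJetMap_comp_twistJetPullbackHom pullback_map_toTwistHodgeZero_comp_twistHodgePullbackHom toTwistHodgeZero)
open Summit.Ventures.HSemireg

variable {S : Type u} [CommRing S] {X₀ X₁ : Over (Spec (CommRingCat.of S))} (g : X₀ ⟶ X₁)

/-! ## §1 The chain-level jet comparison and the morphism of termwise twisted Atiyah sequences -/

section ChainLevel

variable (j : ℕ) (K : CochainComplex X₁.left.Modules ℤ) (hK : ∀ p, IsFiniteLocallyFree (K.X p))

/-- **`g^*• Pʲ(K) ⟶ Pʲ(g^*•K)`** — termwise the base-change morphism of the twisted jet modules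
(`Literature.AlgebraicGeometry.HodgeTheory.twistJetPullbackHom`), a chain map by its naturality in the module
(`pullback_map_twistJetMap_comp_twistJetPullbackHom`). [cite: Atiyah1957, §4 Prop. 6–7 (functoriality of the jet extension)]
[cite: BuchweitzFlenner2003, §3 (Atiyah class of a complex; base change)] -/
def twistJetComplexPullbackHom :
    ((Scheme.Modules.pullback g.left).mapHomologicalComplex (ComplexShape.up ℤ)).obj
        (((twistJetFunctor X₁ j).mapHomologicalComplex (ComplexShape.up ℤ)).obj K) ⟶
      ((twistJetFunctor X₀ j).mapHomologicalComplex (ComplexShape.up ℤ)).obj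
        (((Scheme.Modules.pullback g.left).mapHomologicalComplex (ComplexShape.up ℤ)).obj K) where
  f i := twistJetPullbackHom g (hK i) j
  comm' i i' _ := by
    change twistJetPullbackHom g (hK i) j ≫
        Literature.AlgebraicGeometry.HodgeTheory.twistJetMap ((Scheme.Modules.pullback g.left).map (K.d i i')) j =
      (Scheme.Modules.pullback g.left).map (Literature.AlgebraicGeometry.HodgeTheory.twistJetMap (K.d i i') j) ≫
        twistJetPullbackHom g (hK i') j
    exact (pullback_map_twistJetMap_comp_twistJetPullbackHom g (K.d i i') (hK i) (hK i') j).symm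

/-- Components of `twistJetComplexPullbackHom` (definitional). [cite: Atiyah1957, §4 Prop. 6–7] -/
@[simp]
theorem twistJetComplexPullbackHom_f (i : ℤ) : (twistJetComplexPullbackHom g j K hK).f i = twistJetPullbackHom g (hK i) j := rfl

/-- **The morphism of termwise twisted Atiyah sequences** `g^*•(0 → K⊗Ωʲ⁺¹ → Pʲ(K) → K⊗Ωʲ → 0) ⟶ (0 → K'⊗Ωʲ⁺¹ → Pʲ(K') → K'⊗Ωʲ → 0)`,
`K' = g^*•K`, with components `α_{j+1}•`, the jet comparison, `α_j•` (compatibility with `ι`, `π` termwise: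
`pullback_map_twistJetι_comp_twistJetPullbackHom`, `pullback_map_twistJetπ_comp_twistHodgePullbackHom`).
[cite: BuchweitzFlenner2003, §3 (Atiyah class of a complex; base change)] -/
def twistJetComplexShortComplexPullbackHom :
    (twistJetComplexShortComplex X₁ j K).map ((Scheme.Modules.pullback g.left).mapHomologicalComplex (ComplexShape.up ℤ)) ⟶
      twistJetComplexShortComplex X₀ j (((Scheme.Modules.pullback g.left).mapHomologicalComplex (ComplexShape.up ℤ)).obj K) where
  τ₁ := twistHodgeComplexPullbackHom g (j + 1) K hK
  τ₂ := twistJetComplexPullbackHom g j K hK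
  τ₃ := twistHodgeComplexPullbackHom g j K hK
  comm₁₂ := by
    refine HomologicalComplex.hom_ext _ _ fun i => ?_
    change twistHodgePullbackHom g (hK i) (j + 1) ≫ twistJetι ((Scheme.Modules.pullback g.left).obj (K.X i)) j =
      (Scheme.Modules.pullback g.left).map (twistJetι (K.X i) j) ≫ twistJetPullbackHom g (hK i) j
    exact (pullback_map_twistJetι_comp_twistJetPullbackHom g (hK i) j).symm
  comm₂₃ := by
    refine HomologicalComplex.hom_ext _ _ fun i => ?_
    change twistJetPullbackHom g (hK i) j ≫ twistJetπ ((Scheme.Modules.pullback g.left).obj (K.X i)) j =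
      (Scheme.Modules.pullback g.left).map (twistJetπ (K.X i) j) ≫ twistHodgePullbackHom g (hK i) j
    exact (pullback_map_twistJetπ_comp_twistHodgePullbackHom g (hK i) j).symm

end ChainLevel

/-! ## §2 The Atiyah steps and powers along `g^{**}` -/

section Derived

variable [HasDerivedCategory.{w₀} X₀.left.Modules] [HasDerivedCategory.{w₁} X₁.left.Modules]
  [PreservesFiniteLimits (Scheme.Modules.pullback g.left)]
  (j : ℕ) (K : CochainComplex X₁.left.Modules ℤ) (hK : ∀ p, IsFiniteLocallyFree (K.X p))

/-- **`g^{**}(At_j(K)) = δ(g^*•(0 → K⊗Ωʲ⁺¹ → Pʲ(K) → K⊗Ωʲ → 0))`**: an exact functor maps the connecting morphism of a short exact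
sequence of complexes to that of its image (Mathlib `DerivedCategory.map_triangleOfSESδ`; all factorisation isomorphisms cancel).
[cite: Weibel1994, §10.4 and Example 10.4.9] -/
theorem mapShiftedHom_complexAtiyahStep_pullback :
    mapShiftedHom (Scheme.Modules.pullback g.left) (complexAtiyahStep X₁ j K) =
      triangleOfSESδ ((twistJetComplexShortComplex_shortExact (X := X₁) j K).map_of_exact
        ((Scheme.Modules.pullback g.left).mapHomologicalComplex (ComplexShape.up ℤ))) := by
  unfold mapShiftedHom
  rw [complexAtiyahStep, ShiftedHom.map,
    DerivedCategory.map_triangleOfSESδ (Scheme.Modules.pullback g.left) (twistJetComplexShortComplex_shortExact (X := X₁) j K)]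
  simp only [Category.assoc]
  erw [Iso.inv_hom_id_app_assoc, Iso.inv_hom_id_app_assoc, ← Functor.map_comp, Iso.inv_hom_id_app,
    CategoryTheory.Functor.map_id, Category.comp_id]

/-- **`g^{**}(At_j(K)) · [Q α_{j+1}•] = [Q α_j•] · At_j(g^*•K)`** for `K` with finite locally free terms (naturality of the connecting
morphism along the morphism of twisted Atiyah sequences of §1).
[cite: BuchweitzFlenner2003, §3 (Atiyah class of a complex; functoriality under flat base change)] -/
theorem mapShiftedHom_complexAtiyahStep_comp_pullback :
    (mapShiftedHom (Scheme.Modules.pullback g.left) (complexAtiyahStep X₁ j K)).comp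
        (ShiftedHom.mk₀ (0 : ℤ) rfl (Q.map (twistHodgeComplexPullbackHom g (j + 1) K hK))) (zero_add 1) =
      (ShiftedHom.mk₀ (0 : ℤ) rfl (Q.map (twistHodgeComplexPullbackHom g j K hK))).comp
        (complexAtiyahStep X₀ j (((Scheme.Modules.pullback g.left).mapHomologicalComplex (ComplexShape.up ℤ)).obj K))
          (add_zero 1) := by
  rw [ShiftedHom.comp_mk₀, ShiftedHom.mk₀_comp, mapShiftedHom_complexAtiyahStep_pullback]
  exact DerivedCategory.triangleOfSESδ_naturality _ (twistJetComplexShortComplex_shortExact (X := X₀) j _)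
    (twistJetComplexShortComplexPullbackHom g j K hK)

/-- **`g^{**}(At(K)^q) · [Q α_q•] = [Q α_0•] · At(g^*•K)^q`** (induction on `q`: `g^{**}` is multiplicative, `mapShiftedHom_comp`).
[cite: BuchweitzFlenner2003, Def. 4.1 (powers of the Atiyah class; functoriality under flat base change)] -/
theorem mapShiftedHom_complexAtiyahPower_comp_pullback (q : ℕ) :
    (mapShiftedHom (Scheme.Modules.pullback g.left) (complexAtiyahPower X₁ K q)).comp
        (ShiftedHom.mk₀ (0 : ℤ) rfl (Q.map (twistHodgeComplexPullbackHom g q K hK))) (zero_add _) =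
      (ShiftedHom.mk₀ (0 : ℤ) rfl (Q.map (twistHodgeComplexPullbackHom g 0 K hK))).comp
        (complexAtiyahPower X₀ (((Scheme.Modules.pullback g.left).mapHomologicalComplex (ComplexShape.up ℤ)).obj K) q)
          (add_zero _) := by
  induction q with
  | zero =>
    rw [complexAtiyahPower_zero, complexAtiyahPower_zero]
    erw [ShiftedHom.comp_mk₀_id]
    rw [← (Q (C := X₁.left.Modules)).map_id]
    erw [mapShiftedHom_mk₀]
    rw [CategoryTheory.Functor.map_id, CategoryTheory.Functor.map_id]
    erw [ShiftedHom.mk₀_id_comp]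
  | succ q ih =>
    rw [complexAtiyahPower_succ, complexAtiyahPower_succ, mapShiftedHom_comp, shiftedHom_comp_comp_mk₀,
      mapShiftedHom_complexAtiyahStep_comp_pullback, ← shiftedHom_comp_mk₀_comp, ih, shiftedHom_mk₀_comp_comp]

end Derived

/-! ## §3 `ι•` and the argument of `σ_q` along `g^{**}` -/

section Iota

variable (K : CochainComplex X₁.left.Modules ℤ) (hK : ∀ p, IsFiniteLocallyFree (K.X p))

/-- **`g^*•(ι•_K) ≫ α_0• = ι•_{g^*•K}`** (termwise `pullback_map_toTwistHodgeZero_comp_twistHodgePullbackHom`).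
[cite: Hartshorne1977, II Ex. 5.1 (a), (b) and II Prop. 8.11] -/
theorem map_toTwistHodgeZeroC_comp_pullback :
    ((Scheme.Modules.pullback g.left).mapHomologicalComplex (ComplexShape.up ℤ)).map (toTwistHodgeZeroC X₁ K) ≫
        twistHodgeComplexPullbackHom g 0 K hK =
      toTwistHodgeZeroC X₀ (((Scheme.Modules.pullback g.left).mapHomologicalComplex (ComplexShape.up ℤ)).obj K) := by
  refine HomologicalComplex.hom_ext _ _ fun i => ?_
  rw [HomologicalComplex.comp_f, Functor.mapHomologicalComplex_map_f, twistHodgeComplexPullbackHom_f,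
    toTwistHodgeZeroC_f, toTwistHodgeZeroC_f]
  exact pullback_map_toTwistHodgeZero_comp_twistHodgePullbackHom g (hK i)

variable [HasDerivedCategory.{w₀} X₀.left.Modules] [HasDerivedCategory.{w₁} X₁.left.Modules]
  [PreservesFiniteLimits (Scheme.Modules.pullback g.left)]

/-- **`g^{**}(ι• · At(K)^q) · [Q α_q•] = ι• · At(g^*•K)^q`** (for the composite `complexAtiyahPowerFrom`).
[cite: BuchweitzFlenner2003, Def. 4.1 (functoriality under flat base change)] -/
theorem mapShiftedHom_complexAtiyahPowerFrom_comp_pullback (q : ℕ) :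
    (mapShiftedHom (Scheme.Modules.pullback g.left) (complexAtiyahPowerFrom q K)).comp
        (ShiftedHom.mk₀ (0 : ℤ) rfl (Q.map (twistHodgeComplexPullbackHom g q K hK))) (zero_add _) =
      complexAtiyahPowerFrom q (((Scheme.Modules.pullback g.left).mapHomologicalComplex (ComplexShape.up ℤ)).obj K) := by
  rw [complexAtiyahPowerFrom, complexAtiyahPowerFrom, mapShiftedHom_mk₀_comp, shiftedHom_mk₀_comp_comp,
    mapShiftedHom_complexAtiyahPower_comp_pullback, ← shiftedHom_mk₀_comp_comp, ShiftedHom.mk₀_comp_mk₀, ← Functor.map_comp,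
    map_toTwistHodgeZeroC_comp_pullback]

/-- **The argument of `σ_q` along `g^{**}`**: `g^{**}(x · ι• · At(K)^q) · [Q α_q•] = g^{**}(x) · ι• · At(g^*•K)^q` for every
`x ∈ Ext²(K, K) = Hom_D(Q K, (Q K)⟦2⟧)` — the pull-back twin of the venture's `mapShiftedHom_extMulAtiyahPower_comp`.
[cite: BuchweitzFlenner2003, Def. 4.1 and §3 (functoriality of At under flat base change)] -/
theorem mapShiftedHom_extMulAtiyahPower_comp_pullback (q : ℕ) (x : ShiftedHom (Q.obj K) (Q.obj K) (2 : ℤ)) :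
    (mapShiftedHom (Scheme.Modules.pullback g.left) (extMulAtiyahPower X₁ K q x)).comp
        (ShiftedHom.mk₀ (0 : ℤ) rfl (Q.map (twistHodgeComplexPullbackHom g q K hK))) (zero_add _) =
      extMulAtiyahPower X₀ (((Scheme.Modules.pullback g.left).mapHomologicalComplex (ComplexShape.up ℤ)).obj K) q
        (mapShiftedHom (Scheme.Modules.pullback g.left) x) := by
  rw [extMulAtiyahPower_eq_comp, extMulAtiyahPower_eq_comp, mapShiftedHom_comp, shiftedHom_comp_comp_mk₀,
    mapShiftedHom_complexAtiyahPowerFrom_comp_pullback]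

end Iota

end Summit.HodgeConjecture.HodgeConjecture.Ring2.SemiregularRepresentatives

end
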